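import Literature.Topology.FourManifolds.CollarUniquenessBall
import Literature.Topology.FourManifolds.RadialExtension
import HarnessLib

/-!
# Filling a sphere-preserving shell embedding by a ball (Cerf's `Γ₄ = 0` + uniqueness of collars)

Trunk T-4MAN (`Literature/Topology/FourManifolds`). An elementary consequence of Cerf's theorem
`π₀ Diff(S³) = 0` (`Literature.Topology.FourManifolds.cerf_pi0Diff_sphere_three`,
`RadialExtension.lean`) and of the uniqueness of collars of `∂𝔻⁴` in the ambient form of
`CollarUniquenessBall.lean` (`IsInnerCollar.exists_openPartialHomeomorph_extend`), needed for the
reconstruction of a 4-manifold from the outcome of a surgery when the surgery caps are matched to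
the necks only up to a diffeomorphism of `S³` (Hamilton 1997, §1.1; Chen–Zhu 2006, Thm. 1.1
(ii)–(iii); see `Literature/Geometry/Riemannian/SurgicalRicciFlowTopology.lean`):

* `Literature.Topology.FourManifolds.exists_twoSidedShell_subset`: an open set containing the unit
  sphere of a finite-dimensional real normed space contains a two-sided shell
  `{1 - δ < ‖x‖ < 1 + δ}`.
* `Literature.Topology.FourManifolds.exists_diffeomorph_extend_of_cerf_pi0Diff`: **Cerf, ambient
  form** — given `π₀ Diff(S³) = 0`, every self-diffeomorphism `φ` of `S³` is the restriction of a
  norm-preserving self-diffeomorphism `Γ` of `ℝ⁴` (radial extension of a diffeotopy, composed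
  with a linear reflection in the orientation-reversing case).
* `Literature.Topology.FourManifolds.exists_ballFill_of_shellEmbedding` (**main result**): let
  `f` be a `C^∞` embedding of a two-sided shell `{1 - ε < ‖x‖ < 1 + ε} ⊆ ℝ⁴` into `ℝ⁴` which maps
  the unit sphere onto itself, the inner half-shell into the open unit ball and the outer
  half-shell into its exterior. Then, given Cerf's theorem, there is a `C^∞` embedding `F` of
  the ball `B(0, 1 + δ)` (some `0 < δ ≤ ε`) which **agrees with `f` on the thin two-sided shell**
  `{1 - δ < ‖x‖ < 1 + δ}`, maps the open unit ball onto itself, and has image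
  `B(0, 1) ∪ f({1 - δ < ‖x‖ < 1 + δ})`, with a `C^∞` inverse on that image. In words: the germ
  along `S³` of a diffeomorphism between collared 3-spheres extends to a diffeomorphism of the
  4-balls they bound.

## Proof of the main result

Restrict `f` to the sphere: a diffeomorphism `φ` of `S³`. By Cerf (ambient form) `φ = Γ|_{S³}`
with `Γ ∈ Diff(ℝ⁴)` norm-preserving; then `g = Γ⁻¹ ∘ f` fixes `S³` pointwise, so its restriction
to the inner closed shell `{1 - ε₁ < ‖x‖ ≤ 1}` is an inner collar of `∂𝔻⁴` in the sense of
`CollarUniquenessBall.lean`. By `IsInnerCollar.exists_openPartialHomeomorph_extend` there is a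
diffeomorphism `Θ` of the open unit ball with `Θ = g` on a thin shell `{1 - δ ≤ ‖x‖ < 1}`. The map
`G = Θ` on the open ball, `G = g` outside, then agrees with `g` on the two-sided shell
`{1 - δ ≤ ‖x‖ < 1 + ε}`, hence is `C^∞` and injective on `B(0, 1 + δ)`, and `F = Γ ∘ G` is the
required filling. (Milnor, *Lectures on the h-cobordism theorem* (1965), §9, proof that
`Σ(φ) ≅ S⁴` iff `φ` extends; Hirsch (1976), Ch. 8, Thm. 2.1.)

## References

* J. Cerf, *Sur les difféomorphismes de la sphère de dimension trois (Γ₄ = 0)*, LNM 53 (1968),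
  Ch. I §1, Théorème 1, Lemme 2, Corollaire 1.
* J. Milnor, *Lectures on the h-cobordism theorem*, Princeton (1965), §9.
* M. W. Hirsch, *Differential Topology*, GTM 33 (1976), Ch. 8, Thms. 1.8, 2.1.
-/

open scoped Manifold ContDiff Topology
open Set Function Metric

noncomputable section

namespace Literature.Topology.FourManifolds

/-! ### Two-sided shells around the unit sphere -/

section Shell

variable {E : Type*} [NormedAddCommGroup E] [NormedSpace ℝ E] [FiniteDimensional ℝ E]

/-- **An open neighbourhood of the unit sphere contains a two-sided shell**
`{1 - δ < ‖x‖ < 1 + δ}` (compactness of the sphere in a finite-dimensional space: the continuous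
function `|‖x‖ - 1|` has a positive minimum on the compact set `𝔻(0, 2) ∖ U`). [folklore] -/
theorem exists_twoSidedShell_subset {U : Set E} (hU : IsOpen U) (hS : sphere (0 : E) 1 ⊆ U) :
    ∃ δ : ℝ, 0 < δ ∧ δ ≤ 1 / 2 ∧ ∀ x : E, 1 - δ < ‖x‖ → ‖x‖ < 1 + δ → x ∈ U := by
  set K : Set E := closedBall (0 : E) 2 ∩ Uᶜ with hK
  have hKc : IsCompact K := (isCompact_closedBall (0 : E) 2).inter_right hU.isClosed_compl
  by_cases hne : K.Nonempty
  · obtain ⟨x₀, hx₀, hmin⟩ :=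
      hKc.exists_isMinOn hne (continuous_norm.sub continuous_const).abs.continuousOn
    have hx₀1 : ‖x₀‖ ≠ 1 := fun h => hx₀.2 (hS (mem_sphere_zero_iff_norm.2 h))
    have hm : 0 < |‖x₀‖ - 1| := abs_pos.2 (sub_ne_zero.2 hx₀1)
    refine ⟨min (|‖x₀‖ - 1|) (1 / 2), lt_min hm (by norm_num), min_le_right _ _,
      fun x h1 h2 => ?_⟩
    by_contra hxU
    have hxK : x ∈ K := by
      refine ⟨mem_closedBall_zero_iff.2 ?_, hxU⟩
      linarith [min_le_right (|‖x₀‖ - 1|) (1 / 2)]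
    have hle : |‖x₀‖ - 1| ≤ |‖x‖ - 1| := hmin hxK
    have hlt : |‖x‖ - 1| < min (|‖x₀‖ - 1|) (1 / 2) := by
      rw [abs_sub_lt_iff]; constructor <;> linarith
    linarith [min_le_left (|‖x₀‖ - 1|) (1 / 2)]
  · refine ⟨1 / 2, by norm_num, le_rfl, fun x h1 h2 => ?_⟩
    by_contra hxU
    exact hne ⟨x, mem_closedBall_zero_iff.2 (by linarith), hxU⟩

end Shell

/-! ### Cerf's theorem in ambient form -/

section Cerf

/-- **Cerf's `Γ₄ = 0`, ambient form.** If every self-diffeomorphism of `S³` is diffeotopic to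
the identity or to a hyperplane reflection (Cerf 1968, Théorème 1, the named fact
`cerf_pi0Diff_sphere_three`), then every self-diffeomorphism `φ` of `S³` is the restriction of a
**norm-preserving self-diffeomorphism `Γ` of `ℝ⁴`**: the radial extension
`x ↦ ‖x‖ · F_{‖x‖}(x/‖x‖)` (`Diffeotopy.radialExtension`, Cerf's Lemme 2) of a diffeotopy `F`
from `id` to `φ`, precomposed with the ambient linear reflection when `φ` is diffeotopic to a
reflection `ρ` (then `F` runs from `id` to `φ ∘ ρ`). In particular `Γ` preserves the open unit
ball, the unit sphere and its exterior.
[cite: CerfDiffeoSphere1968, Ch. I §1, Théorème 1, Lemme 2 and Corollaire 1] -/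
theorem exists_diffeomorph_extend_of_cerf_pi0Diff (hC : cerf_pi0Diff_sphere_three)
    (φ : (sphere (0 : EuclideanSpace ℝ (Fin 4)) 1) ≃ₘ⟮𝓡 3, 𝓡 3⟯
      (sphere (0 : EuclideanSpace ℝ (Fin 4)) 1)) :
    ∃ Γ : EuclideanSpace ℝ (Fin 4) ≃ₘ[ℝ] EuclideanSpace ℝ (Fin 4),
      (∀ x, ‖Γ x‖ = ‖x‖) ∧
        ∀ z : sphere (0 : EuclideanSpace ℝ (Fin 4)) 1,
          Γ z = ((φ z : sphere (0 : EuclideanSpace ℝ (Fin 4)) 1) : EuclideanSpace ℝ (Fin 4)) := by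
  haveI : Fact (Module.finrank ℝ (EuclideanSpace ℝ (Fin 4)) = 3 + 1) :=
    ⟨finrank_euclideanSpace_fin⟩
  rcases hC (sphereBasePoint 3) φ with h | h
  · obtain ⟨D, hD⟩ := h
    refine ⟨D.radialExtension, fun x => ?_, fun z => ?_⟩
    · rw [Diffeotopy.coe_radialExtension, norm_radialExtensionFun]
    · rw [Diffeotopy.coe_radialExtension, radialExtensionFun_coe_sphere, ← Diffeotopy.coe_stage,
        hD]
  · obtain ⟨D, hD⟩ := h
    set v : sphere (0 : EuclideanSpace ℝ (Fin 4)) 1 := sphereBasePoint 3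
    set R : EuclideanSpace ℝ (Fin 4) ≃L[ℝ] EuclideanSpace ℝ (Fin 4) :=
      ((ℝ ∙ (v : EuclideanSpace ℝ (Fin 4)))ᗮ.reflection).toContinuousLinearEquiv with hR
    refine ⟨R.toDiffeomorph.trans D.radialExtension, fun x => ?_, fun z => ?_⟩
    · rw [Diffeomorph.coe_trans, comp_apply, ContinuousLinearEquiv.coe_toDiffeomorph,
        Diffeotopy.coe_radialExtension, norm_radialExtensionFun]
      exact ((ℝ ∙ (v : EuclideanSpace ℝ (Fin 4)))ᗮ.reflection).norm_map x
    · rw [Diffeomorph.coe_trans, comp_apply, ContinuousLinearEquiv.coe_toDiffeomorph,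
        Diffeotopy.coe_radialExtension]
      have hRz : R (z : EuclideanSpace ℝ (Fin 4)) =
          ((sphereReflection v z : sphere (0 : EuclideanSpace ℝ (Fin 4)) 1) :
            EuclideanSpace ℝ (Fin 4)) := by
        rw [coe_sphereReflection]; rfl
      rw [hRz, radialExtensionFun_coe_sphere, ← Diffeotopy.coe_stage, hD, Diffeomorph.coe_trans,
        comp_apply]
      congr 2
      exact (sphereReflection v).symm_apply_apply z

end Cerf

/-! ### The diffeomorphism of the sphere induced by a shell embedding -/

section SphereMap

variable {E : Type*} [NormedAddCommGroup E] [InnerProductSpace ℝ E] {n : ℕ}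
  [Fact (Module.finrank ℝ E = n + 1)]

/-- **A sphere-preserving shell embedding restricts to a diffeomorphism of the sphere.** If `f`
is `C^∞` on an open set `S ⊇ 𝕊ⁿ`, has a `C^∞` left inverse `finv` on the open set `f '' S`, and
`f '' 𝕊ⁿ = 𝕊ⁿ`, then `z ↦ f z` is a self-diffeomorphism of Mathlib's manifold `𝕊ⁿ`
(`ContMDiff.codRestrict_sphere`, `contMDiff_coe_sphere`). [folklore] -/
theorem exists_diffeomorph_sphere_of_shell {f finv : E → E} {S : Set E}
    (hS : IsOpen S) (hSs : sphere (0 : E) 1 ⊆ S) (hf : ContDiffOn ℝ ∞ f S)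
    (hfo : IsOpen (f '' S)) (hfinv : ContDiffOn ℝ ∞ finv (f '' S))
    (hleft : ∀ x ∈ S, finv (f x) = x) (hsph : f '' sphere (0 : E) 1 = sphere 0 1) :
    ∃ φ : (sphere (0 : E) 1) ≃ₘ⟮𝓡 n, 𝓡 n⟯ (sphere (0 : E) 1),
      (∀ z : sphere (0 : E) 1, ((φ z : sphere (0 : E) 1) : E) = f z) ∧
        ∀ z : sphere (0 : E) 1, ((φ.symm z : sphere (0 : E) 1) : E) = finv z := by
  have hmem : ∀ z : sphere (0 : E) 1, f z ∈ sphere (0 : E) 1 := fun z => by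
    have : f z ∈ f '' sphere (0 : E) 1 := mem_image_of_mem f z.2
    rwa [hsph] at this
  have hpre : ∀ w : sphere (0 : E) 1, ∃ z : E, z ∈ sphere (0 : E) 1 ∧ f z = w := by
    intro w
    have hw : (w : E) ∈ f '' sphere 0 1 := by
      rw [hsph]
      exact w.2
    obtain ⟨z, hz, hzw⟩ := hw
    exact ⟨z, hz, hzw⟩
  have hmem' : ∀ w : sphere (0 : E) 1, finv w ∈ sphere (0 : E) 1 := by
    intro w
    obtain ⟨z, hz, hzw⟩ := hpre w
    rw [← hzw, hleft z (hSs hz)]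
    exact hz
  have hwS : ∀ w : sphere (0 : E) 1, (w : E) ∈ f '' S := by
    intro w
    obtain ⟨z, hz, hzw⟩ := hpre w
    exact ⟨z, hSs hz, hzw⟩
  have h1 : ContMDiff (𝓡 n) 𝓘(ℝ, E) ∞ (fun z : sphere (0 : E) 1 => f z) := fun z =>
    ((hf.contDiffAt (hS.mem_nhds (hSs z.2))).contMDiffAt).comp z contMDiff_coe_sphere.contMDiffAt
  have h2 : ContMDiff (𝓡 n) 𝓘(ℝ, E) ∞ (fun w : sphere (0 : E) 1 => finv w) := fun w =>
    ((hfinv.contDiffAt (hfo.mem_nhds (hwS w))).contMDiffAt).comp w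
      contMDiff_coe_sphere.contMDiffAt
  refine ⟨{ toFun := Set.codRestrict (fun z : sphere (0 : E) 1 => f z) _ hmem
            invFun := Set.codRestrict (fun w : sphere (0 : E) 1 => finv w) _ hmem'
            left_inv := fun z => Subtype.ext (hleft z (hSs z.2))
            right_inv := fun w => Subtype.ext ?_
            contMDiff_toFun := h1.codRestrict_sphere hmem
            contMDiff_invFun := h2.codRestrict_sphere hmem' }, fun z => rfl, fun z => rfl⟩
  obtain ⟨z, hz, hzw⟩ := hpre w
  simp only [val_codRestrict_apply]
  rw [← hzw, hleft z (hSs hz)]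

end SphereMap


/-! ### Filling the shell embedding by a ball -/

section Fill

/-- **A homeomorphism onto an open set is an open map**: if `f` has a left inverse `finv` on `S`
which is continuous on the open set `f '' S`, then `f` maps open subsets of `S` to open sets
(`f '' O = f '' S ∩ finv ⁻¹' O`). [folklore] -/
theorem isOpen_image_of_leftInvOn {α β : Type*} [TopologicalSpace α] [TopologicalSpace β]
    {f : α → β} {finv : β → α} {S O : Set α} (hfo : IsOpen (f '' S))
    (hfinv : ContinuousOn finv (f '' S)) (hleft : ∀ x ∈ S, finv (f x) = x) (hO : IsOpen O)
    (hOS : O ⊆ S) : IsOpen (f '' O) := by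
  have : f '' O = f '' S ∩ finv ⁻¹' O := by
    apply Subset.antisymm
    · rintro _ ⟨x, hx, rfl⟩
      exact ⟨⟨x, hOS hx, rfl⟩, by rw [mem_preimage, hleft x (hOS hx)]; exact hx⟩
    · rintro y ⟨⟨x, hx, rfl⟩, hy⟩
      rw [mem_preimage, hleft x hx] at hy
      exact ⟨x, hy, rfl⟩
  rw [this]
  exact hfinv.isOpen_inter_preimage hfo hO

/-- **Filling a sphere-preserving shell embedding by a ball** (given Cerf's `π₀ Diff(S³) = 0`).
Let `f` be `C^∞` and injective on the two-sided shell `S = {1 - ε < ‖x‖ < 1 + ε} ⊆ ℝ⁴`, with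
open image and a `C^∞` inverse `finv` there, mapping the unit sphere onto itself, the inner
half-shell into the open unit ball and the outer half-shell into its exterior. Then there are
`0 < δ ≤ ε` and a `C^∞` injective `F` on the ball `B(0, 1 + δ)`, with a `C^∞` inverse `Finv` on
its (open) image, such that `F = f` on `{1 - δ < ‖x‖ < 1 + δ}`, `F(B(0,1)) = B(0,1)`, and
`F(B(0, 1 + δ)) = B(0, 1) ∪ f({1 ≤ ‖x‖ < 1 + δ})`. Proof: `f|_{S³} = Γ|_{S³}` for a
norm-preserving `Γ ∈ Diff(ℝ⁴)` (`exists_diffeomorph_extend_of_cerf_pi0Diff`); `g = Γ⁻¹ ∘ f` is an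
inner collar of `∂𝔻⁴` (`IsInnerCollar`), so agrees near the sphere with a diffeomorphism `Θ` of
the open ball (`IsInnerCollar.exists_openPartialHomeomorph_extend`); `F = Γ ∘ (Θ` inside`, g`
outside`)`. This is the step "`Σ(φ) ≅ S⁴` when `φ` extends over the ball" of Milnor's *Lectures on
the h-cobordism theorem*, §9, in the form needed to compare two cappings of a neck.
[cite: CerfDiffeoSphere1968, Ch. I §1, Théorème 1 and Corollaire 1] -/
theorem exists_ballFill_of_shellEmbedding (hC : cerf_pi0Diff_sphere_three)
    {f finv : (EuclideanSpace ℝ (Fin 4)) → EuclideanSpace ℝ (Fin 4)} {ε : ℝ} (hε : 0 < ε)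
    (hf : ContDiffOn ℝ ∞ f {x | 1 - ε < ‖x‖ ∧ ‖x‖ < 1 + ε})
    (hfo : IsOpen (f '' {x | 1 - ε < ‖x‖ ∧ ‖x‖ < 1 + ε}))
    (hfinv : ContDiffOn ℝ ∞ finv (f '' {x | 1 - ε < ‖x‖ ∧ ‖x‖ < 1 + ε}))
    (hleft : ∀ x : EuclideanSpace ℝ (Fin 4), 1 - ε < ‖x‖ → ‖x‖ < 1 + ε → finv (f x) = x)
    (hsph : f '' sphere 0 1 = sphere 0 1)
    (hin : ∀ x : EuclideanSpace ℝ (Fin 4), 1 - ε < ‖x‖ → ‖x‖ < 1 → ‖f x‖ < 1)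
    (hout : ∀ x : EuclideanSpace ℝ (Fin 4), 1 < ‖x‖ → ‖x‖ < 1 + ε → 1 < ‖f x‖) :
    ∃ (F Finv : (EuclideanSpace ℝ (Fin 4)) → EuclideanSpace ℝ (Fin 4)) (δ : ℝ), 0 < δ ∧ δ ≤ ε ∧
      ContDiffOn ℝ ∞ F (ball 0 (1 + δ)) ∧
      (∀ x : EuclideanSpace ℝ (Fin 4), 1 - δ < ‖x‖ → ‖x‖ < 1 + δ → F x = f x) ∧
      F '' ball 0 1 = ball 0 1 ∧
      F '' ball 0 (1 + δ) = ball 0 1 ∪ f '' {x | 1 ≤ ‖x‖ ∧ ‖x‖ < 1 + δ} ∧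
      IsOpen (F '' ball 0 (1 + δ)) ∧
      ContDiffOn ℝ ∞ Finv (F '' ball 0 (1 + δ)) ∧
      ∀ x ∈ ball (0 : EuclideanSpace ℝ (Fin 4)) (1 + δ), Finv (F x) = x := by
  set S : Set (EuclideanSpace ℝ (Fin 4)) := {x | 1 - ε < ‖x‖ ∧ ‖x‖ < 1 + ε} with hSdef
  have hSo : IsOpen S :=
    (isOpen_lt continuous_const continuous_norm).inter (isOpen_lt continuous_norm continuous_const)
  have hSs : sphere (0 : EuclideanSpace ℝ (Fin 4)) 1 ⊆ S := fun x hx => by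
    rw [mem_sphere_zero_iff_norm] at hx
    exact ⟨by rw [hx]; linarith, by rw [hx]; linarith⟩
  have hleft' : ∀ x ∈ S, finv (f x) = x := fun x hx => hleft x hx.1 hx.2
  -- Step 1: the diffeomorphism of the sphere and Cerf's ambient extension
  haveI : Fact (Module.finrank ℝ (EuclideanSpace ℝ (Fin 4)) = 3 + 1) :=
    ⟨finrank_euclideanSpace_fin⟩
  obtain ⟨φ, hφ, -⟩ := exists_diffeomorph_sphere_of_shell (n := 3) hSo hSs hf hfo hfinv hleft' hsph
  obtain ⟨Γ, hΓn, hΓs⟩ := exists_diffeomorph_extend_of_cerf_pi0Diff hC φ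
  have hΓn' : ∀ y, ‖Γ.symm y‖ = ‖y‖ := fun y => by
    have := hΓn (Γ.symm y); rw [Γ.apply_symm_apply] at this; exact this.symm
  have hΓd : ContDiff ℝ ∞ Γ := contMDiff_iff_contDiff.1 Γ.contMDiff
  have hΓd' : ContDiff ℝ ∞ Γ.symm := contMDiff_iff_contDiff.1 Γ.symm.contMDiff
  have hΓf : ∀ x, ‖x‖ = 1 → Γ x = f x := fun x hx => by
    have h := hΓs ⟨x, mem_sphere_zero_iff_norm.2 hx⟩
    rw [hφ] at h
    exact h
  -- Step 2: `g = Γ⁻¹ ∘ f` fixes the sphere pointwise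
  set g : (EuclideanSpace ℝ (Fin 4)) → EuclideanSpace ℝ (Fin 4) := fun x => Γ.symm (f x) with hgdef
  set ginv : EuclideanSpace ℝ (Fin 4) → EuclideanSpace ℝ (Fin 4) := fun y => finv (Γ y)
    with hginvdef
  have hg_sph : ∀ x, ‖x‖ = 1 → g x = x := fun x hx => by
    simp only [hgdef]
    rw [← hΓf x hx, Γ.symm_apply_apply]
  have hg_norm : ∀ x, ‖g x‖ = ‖f x‖ := fun x => hΓn' (f x)
  have hginv_g : ∀ x ∈ S, ginv (g x) = x := fun x hx => by
    simp only [hgdef, hginvdef]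
    rw [Γ.apply_symm_apply, hleft' x hx]
  have hgS : ContDiffOn ℝ ∞ g S := hΓd'.comp_contDiffOn hf
  -- the image `T = g(S)` is an open neighbourhood of the sphere on which `ginv` is smooth
  set T : Set (EuclideanSpace ℝ (Fin 4)) := g '' S with hTdef
  have hT : T = Γ.symm '' (f '' S) := by rw [hTdef, image_image]
  have hTo : IsOpen T := by rw [hT]; exact Γ.symm.toHomeomorph.isOpenMap _ hfo
  have hTs : sphere (0 : EuclideanSpace ℝ (Fin 4)) 1 ⊆ T := fun x hx =>
    ⟨x, hSs hx, hg_sph x (mem_sphere_zero_iff_norm.1 hx)⟩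
  have hΓT : MapsTo Γ T (f '' S) := by
    rintro _ ⟨x, hx, rfl⟩
    simp only [hgdef]
    rw [Γ.apply_symm_apply]
    exact mem_image_of_mem f hx
  have hginvT : ContDiffOn ℝ ∞ ginv T := hfinv.comp hΓd.contDiffOn hΓT
  -- `g` maps open subsets of `S` to open sets
  have hg_open : ∀ O : Set _, IsOpen O → O ⊆ S → IsOpen (g '' O) := fun O hO hOS => by
    have : g '' O = Γ.symm '' (f '' O) := by rw [image_image]
    rw [this]
    exact Γ.symm.toHomeomorph.isOpenMap _
      (isOpen_image_of_leftInvOn hfo hfinv.continuousOn hleft' hO hOS)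
  -- Step 3: a thin shell inside `S ∩ T`, and the inner collar
  obtain ⟨ε₁, hε₁, -, hε₁S⟩ := exists_twoSidedShell_subset (hTo.inter hSo)
    (subset_inter hTs hSs)
  set ε₂ : ℝ := min ε₁ ε with hε₂def
  have hε₂ : 0 < ε₂ := lt_min hε₁ hε
  have hε₂S : ∀ x, 1 - ε₂ < ‖x‖ → ‖x‖ < 1 + ε₂ → x ∈ T ∩ S := fun x h1 h2 =>
    hε₁S x (by linarith [min_le_left ε₁ ε] ) (by linarith [min_le_left ε₁ ε])
  have hshellS : closedShell ε₂ ⊆ (T ∩ S : Set (EuclideanSpace ℝ (Fin 4))) := fun x hx => by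
    rw [mem_closedShell_iff] at hx
    exact hε₂S x hx.1 (by linarith [hx.2])
  have hcollar : IsInnerCollar ε₂ g ginv :=
    { pos := hε₂
      contDiffOn := hgS.mono fun x hx => (hshellS hx).2
      contDiffOn_symm := hginvT.mono fun x hx => (hshellS hx).1
      eq_self := hg_sph
      norm_le_one := fun x hx => by
        rcases (mem_closedShell_iff.1 hx).2.lt_or_eq with h | h
        · rw [hg_norm]; exact (hin x (hshellS hx).2.1 h).le
        · rw [hg_sph x h, h]
      norm_lt_one := fun x hx h => by
        rw [hg_norm]; exact hin x (hshellS hx).2.1 h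
      left_inv := fun x hx _ => hginv_g x (hshellS hx).2 }
  -- Step 4: uniqueness of collars
  obtain ⟨Θ, δ, hδ, hδε, hΘs, hΘt, hΘc, hΘc', hΘg, -⟩ := hcollar.exists_openPartialHomeomorph_extend
  have hδε' : δ ≤ ε := (hδε.le.trans (min_le_right _ _))
  have hδS : ∀ x, 1 - δ < ‖x‖ → ‖x‖ < 1 + δ → x ∈ T ∩ S := fun x h1 h2 =>
    hε₂S x (by linarith) (by linarith)
  -- Step 5: the maps `G`, `Ginv`
  set G : EuclideanSpace ℝ (Fin 4) → EuclideanSpace ℝ (Fin 4) :=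
    fun x => if ‖x‖ < 1 then Θ x else g x with hGdef
  set Ginv : EuclideanSpace ℝ (Fin 4) → EuclideanSpace ℝ (Fin 4) :=
    fun y => if ‖y‖ < 1 then Θ.symm y else ginv y with hGinvdef
  have hGg : ∀ x, 1 - δ < ‖x‖ → ‖x‖ < 1 + δ → G x = g x := fun x h1 h2 => by
    simp only [hGdef]
    split_ifs with h
    · exact hΘg x h1.le h
    · rfl
  have hGball : ∀ x, ‖x‖ < 1 → G x = Θ x := fun x h => by simp only [hGdef, if_pos h]
  have hΘmap : ∀ x, ‖x‖ < 1 → ‖Θ x‖ < 1 := fun x hx => by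
    have := Θ.map_source (x := x) (by rw [hΘs]; exact mem_ball_zero_iff.2 hx)
    rw [hΘt] at this
    exact mem_ball_zero_iff.1 this
  have hΘmap' : ∀ y : EuclideanSpace ℝ (Fin 4), ‖y‖ < 1 → ‖Θ.symm y‖ < 1 := fun y hy => by
    have := Θ.map_target (x := y) (by rw [hΘt]; exact mem_ball_zero_iff.2 hy)
    rw [hΘs] at this
    exact mem_ball_zero_iff.1 this
  have hg_ge : ∀ x, 1 ≤ ‖x‖ → ‖x‖ < 1 + δ → 1 ≤ ‖g x‖ := fun x h1 h2 => by
    rcases h1.lt_or_eq with h | h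
    · rw [hg_norm]; exact (hout x h (by linarith)).le
    · rw [hg_sph x h.symm, ← h]
  -- `G` is smooth on the ball of radius `1 + δ`
  have hGsmooth : ContDiffOn ℝ ∞ G (ball 0 (1 + δ)) := by
    intro x hx
    rw [mem_ball_zero_iff] at hx
    refine ContDiffAt.contDiffWithinAt ?_
    by_cases h1 : ‖x‖ < 1
    · have hev : G =ᶠ[𝓝 x] Θ := by
        filter_upwards [isOpen_ball.mem_nhds (mem_ball_zero_iff.2 h1)] with y hy
        exact hGball y (mem_ball_zero_iff.1 hy)
      refine ContDiffAt.congr_of_eventuallyEq ?_ hev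
      exact hΘc.contDiffAt (isOpen_ball.mem_nhds (mem_ball_zero_iff.2 h1))
    · have h1 : 1 ≤ ‖x‖ := not_lt.1 h1
      have hO : IsOpen {y : EuclideanSpace ℝ (Fin 4) | 1 - δ < ‖y‖ ∧ ‖y‖ < 1 + δ} :=
        (isOpen_lt continuous_const continuous_norm).inter
          (isOpen_lt continuous_norm continuous_const)
      have hev : G =ᶠ[𝓝 x] g := by
        filter_upwards [hO.mem_nhds ⟨by linarith, hx⟩] with y hy
        exact hGg y hy.1 hy.2
      refine ContDiffAt.congr_of_eventuallyEq ?_ hev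
      exact hgS.contDiffAt (hSo.mem_nhds (hδS x (by linarith) hx).2)
  -- `Ginv ∘ G = id` on the ball of radius `1 + δ`
  have hGinvG : ∀ x, ‖x‖ < 1 + δ → Ginv (G x) = x := fun x hx => by
    by_cases h1 : ‖x‖ < 1
    · rw [hGball x h1]
      simp only [hGinvdef, if_pos (hΘmap x h1)]
      exact Θ.left_inv (by rw [hΘs]; exact mem_ball_zero_iff.2 h1)
    · have h1 : 1 ≤ ‖x‖ := not_lt.1 h1
      rw [hGg x (by linarith) hx]
      simp only [hGinvdef, if_neg (not_lt.2 (hg_ge x h1 hx))]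
      exact hginv_g x (hδS x (by linarith) hx).2
  -- the image of the ball
  have hGimage1 : G '' ball 0 1 = ball 0 1 := by
    have : G '' ball 0 1 = Θ '' ball 0 1 :=
      image_congr fun x hx => hGball x (mem_ball_zero_iff.1 hx)
    have h2 : Θ '' ball 0 1 = ball 0 1 := by
      have h3 := Θ.image_source_eq_target
      rwa [hΘs, hΘt] at h3
    rw [this, h2]
  have hball_split :
      ball (0 : EuclideanSpace ℝ (Fin 4)) (1 + δ) = ball 0 1 ∪ {x | 1 ≤ ‖x‖ ∧ ‖x‖ < 1 + δ} := by
    ext x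
    simp only [mem_ball_zero_iff, mem_union, mem_setOf_eq]
    constructor
    · intro h
      by_cases h1 : ‖x‖ < 1
      · exact Or.inl h1
      · exact Or.inr ⟨not_lt.1 h1, h⟩
    · rintro (h | h)
      · linarith
      · exact h.2
  have hGimage : G '' ball 0 (1 + δ) = ball 0 1 ∪ g '' {x | 1 ≤ ‖x‖ ∧ ‖x‖ < 1 + δ} := by
    rw [hball_split, image_union, hGimage1]
    congr 1
    exact image_congr fun x hx => hGg x (by linarith [hx.1]) hx.2
  -- `Ginv` is smooth on the image
  have hGinv_smooth : ContDiffOn ℝ ∞ Ginv (G '' ball 0 (1 + δ)) := by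
    intro y hy
    refine ContDiffAt.contDiffWithinAt ?_
    rw [hGimage] at hy
    by_cases h1 : ‖y‖ < 1
    · have hev : Ginv =ᶠ[𝓝 y] Θ.symm := by
        filter_upwards [isOpen_ball.mem_nhds (mem_ball_zero_iff.2 h1)] with y' hy'
        simp only [hGinvdef, if_pos (mem_ball_zero_iff.1 hy')]
      refine ContDiffAt.congr_of_eventuallyEq ?_ hev
      exact hΘc'.contDiffAt (isOpen_ball.mem_nhds (mem_ball_zero_iff.2 h1))
    · rcases hy with hy | ⟨x, hx, rfl⟩
      · exact absurd (mem_ball_zero_iff.1 hy) h1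
      -- near `g x` the map `Ginv` is `ginv`
      set O : Set (EuclideanSpace ℝ (Fin 4)) := {x' | 1 - δ < ‖x'‖ ∧ ‖x'‖ < 1 + δ}
        with hOdef
      have hO : IsOpen O := (isOpen_lt continuous_const continuous_norm).inter
        (isOpen_lt continuous_norm continuous_const)
      have hOS : O ⊆ S := fun x' hx' => (hδS x' hx'.1 hx'.2).2
      have hxO : x ∈ O := ⟨by linarith [hx.1], hx.2⟩
      have hev : Ginv =ᶠ[𝓝 (g x)] ginv := by
        filter_upwards [(hg_open O hO hOS).mem_nhds (mem_image_of_mem g hxO)] with y' hy'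
        obtain ⟨x', hx', rfl⟩ := hy'
        simp only [hGinvdef]
        split_ifs with h
        · -- then `‖x'‖ < 1`, `Θ x' = g x'`
          have hx'1 : ‖x'‖ < 1 := by
            by_contra hc
            exact absurd h (not_lt.2 (hg_ge x' (not_lt.1 hc) hx'.2))
          have hΘx' : Θ x' = g x' := hΘg x' hx'.1.le hx'1
          rw [← hΘx', Θ.left_inv (by rw [hΘs]; exact mem_ball_zero_iff.2 hx'1), hΘx',
            hginv_g x' (hOS hx')]
        · rfl
      refine ContDiffAt.congr_of_eventuallyEq ?_ hev
      exact hginvT.contDiffAt (hTo.mem_nhds (mem_image_of_mem g (hOS hxO)))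
  -- Step 6: `F = Γ ∘ G`
  have hΓball : (⇑Γ) '' ball 0 1 = ball 0 1 := by
    apply Subset.antisymm
    · rintro _ ⟨x, hx, rfl⟩
      rw [mem_ball_zero_iff] at hx ⊢
      rwa [hΓn]
    · intro y hy
      refine ⟨Γ.symm y, ?_, Γ.apply_symm_apply y⟩
      rw [mem_ball_zero_iff] at hy ⊢
      rwa [hΓn']
  have hFf : ∀ x, 1 - δ < ‖x‖ → ‖x‖ < 1 + δ → Γ (G x) = f x := fun x h1 h2 => by
    rw [hGg x h1 h2]
    exact Γ.apply_symm_apply (f x)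
  refine ⟨fun x => Γ (G x), fun y => Ginv (Γ.symm y), δ, hδ, hδε', hΓd.comp_contDiffOn hGsmooth,
    hFf, ?_, ?_, ?_, ?_, fun x hx => ?_⟩
  · -- `F '' ball 0 1 = ball 0 1`
    rw [← image_image (g := (⇑Γ)) (f := G), hGimage1, hΓball]
  · -- the image of the big ball
    rw [hball_split, image_union, ← image_image (g := (⇑Γ)) (f := G), hGimage1,
      hΓball]
    congr 1
    exact image_congr fun x hx => hFf x (by linarith [hx.1]) hx.2
  · -- openness of the image
    rw [← image_image (g := (⇑Γ)) (f := G), hGimage, image_union, hΓball]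
    have hO : IsOpen {x : EuclideanSpace ℝ (Fin 4) | 1 - δ < ‖x‖ ∧ ‖x‖ < 1 + δ} :=
      (isOpen_lt continuous_const continuous_norm).inter
        (isOpen_lt continuous_norm continuous_const)
    have hfO : IsOpen (f '' {x | 1 - δ < ‖x‖ ∧ ‖x‖ < 1 + δ}) :=
      isOpen_image_of_leftInvOn hfo hfinv.continuousOn hleft' hO fun x hx => (hδS x hx.1 hx.2).2
    have key : ball 0 1 ∪ (⇑Γ) '' (g '' {x | 1 ≤ ‖x‖ ∧ ‖x‖ < 1 + δ}) =
        ball 0 1 ∪ f '' {x | 1 - δ < ‖x‖ ∧ ‖x‖ < 1 + δ} := by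
      have h1 : (⇑Γ) '' (g '' {x | 1 ≤ ‖x‖ ∧ ‖x‖ < 1 + δ}) =
          f '' {x | 1 ≤ ‖x‖ ∧ ‖x‖ < 1 + δ} := by
        rw [image_image]
        exact image_congr fun x _ => Γ.apply_symm_apply (f x)
      rw [h1]
      apply Subset.antisymm
      · rintro y (hy | ⟨x, hx, rfl⟩)
        · exact Or.inl hy
        · exact Or.inr ⟨x, ⟨by linarith [hx.1], hx.2⟩, rfl⟩
      · rintro y (hy | ⟨x, hx, rfl⟩)
        · exact Or.inl hy
        · by_cases hx1 : ‖x‖ < 1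
          · exact Or.inl (mem_ball_zero_iff.2 (hin x (hδS x hx.1 hx.2).2.1 hx1))
          · exact Or.inr ⟨x, ⟨not_lt.1 hx1, hx.2⟩, rfl⟩
    rw [key]
    exact isOpen_ball.union hfO
  · -- smoothness of the inverse on the image
    have hmaps : MapsTo (⇑Γ.symm) ((fun x => Γ (G x)) '' ball 0 (1 + δ))
        (G '' ball 0 (1 + δ)) := by
      rintro _ ⟨x, hx, rfl⟩
      rw [Γ.symm_apply_apply]
      exact mem_image_of_mem G hx
    exact hGinv_smooth.comp hΓd'.contDiffOn hmaps
  · -- left inverse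
    show Ginv (Γ.symm (Γ (G x))) = x
    rw [Γ.symm_apply_apply]
    exact hGinvG x (mem_ball_zero_iff.1 hx)

end Fill

end Literature.Topology.FourManifolds
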